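import Literature.AlgebraicGeometry.HodgeTheory.LefschetzFormIndexRealHodgeTypes
import HarnessLib

/-!
# The index of the polarization on the real primitive cohomology `Pᵏ_ℝ`, every even degree `k ≤ n`

Family `hodge`, layer `Literature/AlgebraicGeometry/HodgeTheory`; lane `lit-hodgefound`. THEOREMS
ONLY (no definition, no named fact; D-0026). Sequel of `LefschetzFormIndexRealHodgeTypes.lean` (the
general-predicate block engine `sigPos_sigNeg_lefschetzForm_restrict_eq_sum_of_pos` for the real
Lefschetz forms `B_k(y, y') = ⟨Lʳ_{re H_η} y ⌣ y', [X(ℂ)]_μ ⊗ 1⟩`, `k` even, `k + r = n`, `X` smooth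
projective of dimension `n`, `D` a Kähler–rational datum, `μ` a `ℤ`-orientation of `X(ℂ)` pairing
positively with the volume class). Here the set of blocks is `{t = 0}`: the PRIMITIVE cohomology
`Pᵏ = ker L^{n-k+1} ⊆ Hᵏ(X(ℂ); ℂ)` and its real points `Pᵏ_ℝ`, on which `B_k` is the polarization
form `Q(α, β) = ∫_X ω^{n-k} ∧ α ∧ β` of the primitive Hodge structure (Voisin I §7.1.2 (i)–(ii),
Thm. 6.32: "the form `(-1)^{k(k-1)/2} i^{p-q-k} H_k` is positive definite on `H^{p,q}_prim`";
Carlson–Müller-Stach–Peters §4.4: for a polarized Hodge structure of weight `2m` the polarization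
"has signature `(-1)^{p-m}`" on `H^{p,q} ⊕ H^{q,p}` "while on `H^{m,m}` it is positive definite").

* `mem_primitiveClasses_iff_primitivePart_eq_zero` — `x ∈ Pᵏ` iff its Lefschetz components
  `ξ_{(a,t)} x` with `t ≥ 1` vanish; `mem_primitiveClasses_iff_typeProj_primitivePart_eq_zero` — the
  same on the blocks `π_{(s,t')} ξ_{(a,t)} x`;
* **`sigPos_sigNeg_lefschetzForm_restrict_primitive_of_pos`** — on `U = Pᵏ_ℝ`:
  `b⁺ = Σ_{s+t'=k, s even} dim (H^{s,t'} ∩ Pᵏ)`, `b⁻ = Σ_{s odd} dim (H^{s,t'} ∩ Pᵏ)`,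
  `b⁺ + b⁻ = dim_ℝ Pᵏ_ℝ` (the polarization is non-degenerate, of this index);
* **`signature_lefschetzForm_restrict_primitive_eq_sum_hodgeNumber`** — in Hodge numbers
  (`dim (H^{s,t'} ∩ Pᵏ) = h^{s,t'} - h^{s-1,t'-1}`, `k ≤ n`), over `ℤ`;
* **`sigPos_sigNeg_lefschetzForm_restrict_primitive_types_of_pos`** — on the real points of
  `Pᵏ ∩ ⊕_{(p,q) ∈ T} H^{p,q}` for a set of types `T` closed under `(p,q) ↦ (q,p)`: definite of sign
  `(-1)ᵖ` on `(P^{p,q} ⊕ P^{q,p})_ℝ`;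
* `sigPos_sigNeg_lefschetzForm_restrict_primitive_two_of_pos` — `k = 2`, every `n ≥ 2`: on
  `P²_ℝ = {α | ω^{n-1} ∧ α = 0}` the form `∫ ω^{n-2} ∧ α ∧ β` has index `(2 h^{2,0}, h^{1,1} - 1)`;
* `exists_orientation_sigPos_sigNeg_lefschetzForm_restrict_primitive` — orientation-free packaging.

## References

* [VoisinHodgeI2002] C. Voisin, Hodge Theory and Complex Algebraic Geometry I (CUP 2002), §6.2.3
  Cor. 6.26; §6.3.2 Lemma 6.31, Thm. 6.32; §7.1.2 (i)–(ii), Def. 7.7 (PDF pp. 128–129, 134).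
* [CarlsonMullerStachPeters2017] J. Carlson, S. Müller-Stach, C. Peters, Period Mappings and Period
  Domains (2nd ed., CUP 2017), §4.4 (PDF p. 138 of the held text).
* [HuybrechtsCG2005] D. Huybrechts, Complex Geometry (Springer 2005), §3.3, proof of Cor. 3.3.18.
* [Lang1987LinearAlgebra] S. Lang, Linear Algebra (3rd ed., 1987), Ch. V §8 Thm. 8.2 (Sylvester).
-/

noncomputable section

open scoped Manifold ContDiff
open CategoryTheory AlgebraicGeometry Module Bundle Finset
open Literature.AlgebraicTopology.SingularHomology Literature.Geometry.Kaehler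
open Literature.NumberTheory.Transcendental
open Literature.AlgebraicGeometry.Motives (IsSmoothProjective)

namespace Literature.AlgebraicGeometry.HodgeTheory

section Primitive

variable {n : ℕ} {X : Motives.SchemeOver ℂ}

namespace KaehlerRationalDatum

variable (D : KaehlerRationalDatum n X)

/-! ### Primitive classes in terms of the Lefschetz components -/

/-- The Lefschetz index `(k, 0)` of the primitive summand `Pᵏ = L⁰ Pᵏ` of `Hᵏ`. [folklore] -/
private theorem primIndex_mem (k : ℕ) : ((k, 0) : ℕ × ℕ).1 + 2 * ((k, 0) : ℕ × ℕ).2 = k := by simp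

/-- **`x ∈ Pᵏ` iff the Lefschetz components `ξ_{(a,t)} x` with `t ≥ 1` vanish** (`x = Σ Lᵗ ξ_{(a,t)} x`,
uniqueness of the Lefschetz decomposition). [cite: VoisinHodgeI2002, §6.2.3 Cor. 6.26] -/
theorem mem_primitiveClasses_iff_primitivePart_eq_zero (hX : IsSmoothProjective n X) {k : ℕ}
    (x : complexBetti X k) :
    x ∈ primitiveClasses D.Hη n k ↔
      ∀ P : {p : ℕ × ℕ // p.1 + 2 * p.2 = k}, P.1.2 ≠ 0 →
        primitivePart D.Hη n (D.hLℂ hX) (subsingleton_of_lt hX ℂ) P x = 0 := by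
  classical
  have hL0 : ∀ y : complexBetti X k, lefschetzPowTo D.Hη 0 k k (primIndex_mem k) y = y :=
    fun y ↦ lefschetzPowTo_zero_apply D.Hη k y
  have hP₀ : ∀ P : {p : ℕ × ℕ // p.1 + 2 * p.2 = k}, P.1.2 = 0 → P = ⟨(k, 0), primIndex_mem k⟩ := by
    rintro ⟨⟨a, t⟩, hP⟩ h
    simp only at h hP
    subst h
    exact Subtype.ext (Prod.ext (by simp only; omega) rfl)
  constructor
  · intro hx P hP
    have hne : (⟨(k, 0), primIndex_mem k⟩ : {p : ℕ × ℕ // p.1 + 2 * p.2 = k}) ≠ P :=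
      fun h ↦ hP (by rw [← h])
    refine primitivePart_eq_zero_of_mem_ne (D.hLℂ hX) (subsingleton_of_lt hX ℂ) hne ?_
    have h := lefschetzPowTo_mem_lefschetzSummand (κ := D.Hη) (n := n) (t := 0) (primIndex_mem k) hx
    rwa [hL0] at h
  · intro h
    rw [← sum_lefschetzPowTo_primitivePart (D.hLℂ hX) (subsingleton_of_lt hX ℂ) x,
      Finset.sum_eq_single (⟨(k, 0), primIndex_mem k⟩ : {p : ℕ × ℕ // p.1 + 2 * p.2 = k})
        (fun P _ hne ↦ by rw [h P (fun h0 ↦ hne (hP₀ P h0)), map_zero])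
        (fun h' ↦ absurd (Finset.mem_univ _) h')]
    show lefschetzPowTo D.Hη 0 k k (primIndex_mem k) _ ∈ _
    rw [hL0]
    exact primitivePart_mem (D.hLℂ hX) (subsingleton_of_lt hX ℂ) _ x

/-- **`x ∈ Pᵏ` iff the block components `π_{(s,t')} ξ_{(a,t)} x` with `t ≥ 1` vanish.**
[cite: VoisinHodgeI2002, §6.2.3 Cor. 6.26 and Rem. 6.27] -/
theorem mem_primitiveClasses_iff_typeProj_primitivePart_eq_zero (hX : IsSmoothProjective n X)
    (A : HodgeModel n X) {k : ℕ} (x : complexBetti X k) :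
    x ∈ primitiveClasses D.Hη n k ↔
      ∀ (P : {p : ℕ × ℕ // p.1 + 2 * p.2 = k}) (st : ↥(Finset.HasAntidiagonal.antidiagonal P.1.1)),
        P.1.2 ≠ 0 →
          A.typeProj P.1.1 st (primitivePart D.Hη n (D.hLℂ hX) (subsingleton_of_lt hX ℂ) P x) = 0 := by
  rw [D.mem_primitiveClasses_iff_primitivePart_eq_zero hX x]
  refine ⟨fun h P st hP ↦ by rw [h P hP, map_zero], fun h P hP ↦ ?_⟩
  rw [← A.sum_typeProj P.1.1 (primitivePart D.Hη n (D.hLℂ hX) (subsingleton_of_lt hX ℂ) P x)]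
  exact Finset.sum_eq_zero fun st _ ↦ h P st hP

/-! ### The block sums over `{t = 0}` -/

/-- A block sum restricted to the blocks of Lefschetz index `(k, 0)` is a sum over the types of
`Hᵏ`. [folklore] -/
private theorem sum_sum_ite_lefIndex_zero {k : ℕ}
    (g : ∀ a : ℕ, ↥(Finset.HasAntidiagonal.antidiagonal a) → ℕ)
    (c : ∀ a : ℕ, ↥(Finset.HasAntidiagonal.antidiagonal a) → ℕ → Prop) [∀ a st t, Decidable (c a st t)] :
    ∑ P : {x : ℕ × ℕ // x.1 + 2 * x.2 = k}, ∑ st : ↥(Finset.HasAntidiagonal.antidiagonal P.1.1),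
        (if P.1.2 = 0 ∧ c P.1.1 st P.1.2 then g P.1.1 st else 0) =
      ∑ st : ↥(Finset.HasAntidiagonal.antidiagonal k), if c k st 0 then g k st else 0 := by
  classical
  rw [Finset.sum_eq_single (⟨(k, 0), primIndex_mem k⟩ : {x : ℕ × ℕ // x.1 + 2 * x.2 = k})
    (fun P _ hne ↦ Finset.sum_eq_zero fun st _ ↦ if_neg fun h ↦ hne ?_)
    (fun h ↦ absurd (Finset.mem_univ _) h)]
  · show ∑ st : ↥(Finset.HasAntidiagonal.antidiagonal k),
      (if (0 : ℕ) = 0 ∧ c k st 0 then g k st else 0) = _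
    exact Finset.sum_congr rfl fun st _ ↦ by simp only [true_and]
  · obtain ⟨⟨a, t⟩, hP⟩ := P
    obtain ⟨h0, -⟩ := h
    simp only at h0 hP
    subst h0
    exact Subtype.ext (Prod.ext (by simp only; omega) rfl)

/-! ### The index of the polarization on `Pᵏ_ℝ` -/

/-- **The index of the polarization on the real primitive cohomology.** Let `X` be smooth
projective of dimension `n`, `D` a Kähler–rational datum, `k` even, `k + r = n`, `μ` a
`ℤ`-orientation of `X(ℂ)` pairing positively with `y_Ω`, `B_k(y, y') = ⟨Lʳ_{re H_η} y ⌣ y', [X(ℂ)]_μ ⊗ 1⟩`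
the real Lefschetz form (`Q(α, β) = ∫ ω^{n-k} ∧ α ∧ β`), and `U = Pᵏ_ℝ ⊆ Hᵏ(X(ℂ); ℝ)` the real classes
whose complexification is primitive (`L^{n-k+1} (y ⊗ 1) = 0`). Then the restriction of `B_k` to `U`
has `b⁺ = Σ_{s+t'=k, s even} dim (H^{s,t'} ∩ Pᵏ)`, `b⁻ = Σ_{s+t'=k, s odd} dim (H^{s,t'} ∩ Pᵏ)` and
`b⁺ + b⁻ = dim_ℝ U`: `Pᵏ = ⊕_{s+t'=k} (H^{s,t'} ∩ Pᵏ)` orthogonally for `H_k`, with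
`(-1)^{k(k-1)/2} i^{s-t'-k} H_k > 0` on `H^{s,t'}_prim` (Thm. 6.32), i.e. `B_k` definite of sign
`(-1)ˢ` on `(P^{s,t'} ⊕ P^{t',s})_ℝ` — "b has signature `(-1)^{p-m}` \[on `H^{p,q} ⊕ H^{q,p}`\] while on
`H^{m,m}` it is positive definite". [cite: VoisinHodgeI2002, §6.3.2 Thm. 6.32 and §7.1.2 (i)–(ii)]
[cite: CarlsonMullerStachPeters2017, §4.4 (PDF p. 138)] [cite: Lang1987LinearAlgebra, Ch. V §8 Thm. 8.2] -/
theorem sigPos_sigNeg_lefschetzForm_restrict_primitive_of_pos (hX : IsSmoothProjective n X)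
    (A : HodgeModel n X) {k r m : ℕ} (hk : Even k) (hkr : k + r = n) (hm : k + 2 * r = m)
    (hdeg : m + k = 2 * n) (μ : HomologicalOrientation ℤ (Motives.ComplexPoints X) (2 * n))
    (hP : 0 < kroneckerPairing ℝ ℝ (Motives.ComplexPoints X) (2 * n)
      (reClass _ (2 * n) D.topClass)
      (singularHomology.coeffChange (Motives.ComplexPoints X)
        (algebraMap ℤ ℝ : ℤ →+* ℝ).toAddMonoidHom (2 * n) μ.fundamentalClass))
    (U : Submodule ℝ (singularCohomology ℝ ℝ (Motives.ComplexPoints X) k))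
    (hU : ∀ y, y ∈ U ↔ ofRealClass _ k y ∈ primitiveClasses D.Hη n k) :
    sigPos ((LinearMap.BilinMap.toQuadraticMap
        (((cupProduct (R := ℝ) (X := Motives.ComplexPoints X) hdeg).compr₂
          ((kroneckerPairing ℝ ℝ (Motives.ComplexPoints X) (2 * n)).flip
            (singularHomology.coeffChange (Motives.ComplexPoints X)
              (algebraMap ℤ ℝ : ℤ →+* ℝ).toAddMonoidHom (2 * n) μ.fundamentalClass))) ∘ₗ
          lefschetzPowTo (reClass (Motives.ComplexPoints X) 2 D.Hη) r k m hm)).restrict U) =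
        ∑ st : ↥(Finset.HasAntidiagonal.antidiagonal k), (if st.1.1 % 2 = 0 then
          Module.finrank ℂ ↥(A.typePiece k st ⊓ primitiveClasses D.Hη n k) else 0) ∧
      sigNeg ((LinearMap.BilinMap.toQuadraticMap
        (((cupProduct (R := ℝ) (X := Motives.ComplexPoints X) hdeg).compr₂
          ((kroneckerPairing ℝ ℝ (Motives.ComplexPoints X) (2 * n)).flip
            (singularHomology.coeffChange (Motives.ComplexPoints X)
              (algebraMap ℤ ℝ : ℤ →+* ℝ).toAddMonoidHom (2 * n) μ.fundamentalClass))) ∘ₗ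
          lefschetzPowTo (reClass (Motives.ComplexPoints X) 2 D.Hη) r k m hm)).restrict U) =
        ∑ st : ↥(Finset.HasAntidiagonal.antidiagonal k), (if st.1.1 % 2 = 1 then
          Module.finrank ℂ ↥(A.typePiece k st ⊓ primitiveClasses D.Hη n k) else 0) ∧
      sigPos ((LinearMap.BilinMap.toQuadraticMap
        (((cupProduct (R := ℝ) (X := Motives.ComplexPoints X) hdeg).compr₂
          ((kroneckerPairing ℝ ℝ (Motives.ComplexPoints X) (2 * n)).flip
            (singularHomology.coeffChange (Motives.ComplexPoints X)
              (algebraMap ℤ ℝ : ℤ →+* ℝ).toAddMonoidHom (2 * n) μ.fundamentalClass))) ∘ₗ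
          lefschetzPowTo (reClass (Motives.ComplexPoints X) 2 D.Hη) r k m hm)).restrict U) +
      sigNeg ((LinearMap.BilinMap.toQuadraticMap
        (((cupProduct (R := ℝ) (X := Motives.ComplexPoints X) hdeg).compr₂
          ((kroneckerPairing ℝ ℝ (Motives.ComplexPoints X) (2 * n)).flip
            (singularHomology.coeffChange (Motives.ComplexPoints X)
              (algebraMap ℤ ℝ : ℤ →+* ℝ).toAddMonoidHom (2 * n) μ.fundamentalClass))) ∘ₗ
          lefschetzPowTo (reClass (Motives.ComplexPoints X) 2 D.Hη) r k m hm)).restrict U) =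
        Module.finrank ℝ U := by
  have hU' : ∀ y, y ∈ U ↔ ofRealClass _ k y ∈ ⨅ P : {p : ℕ × ℕ // p.1 + 2 * p.2 = k},
      ⨅ st : ↥(Finset.HasAntidiagonal.antidiagonal P.1.1), ⨅ (_ : ¬ (fun P _ ↦ P.1.2 = 0) P st),
        LinearMap.ker (A.typeProj P.1.1 st ∘ₗ
          primitivePart D.Hη n (D.hLℂ hX) (subsingleton_of_lt hX ℂ) P) := fun y ↦ by
    rw [hU, D.mem_primitiveClasses_iff_typeProj_primitivePart_eq_zero hX A]
    simp only [Submodule.mem_iInf, LinearMap.mem_ker, LinearMap.comp_apply, ne_eq]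
  obtain ⟨h1, h2, h3⟩ := D.sigPos_sigNeg_lefschetzForm_restrict_eq_sum_of_pos hX A hk hkr hm hdeg
    μ hP (fun P _ ↦ P.1.2 = 0) (fun P st h ↦ h) U hU'
  refine ⟨h1.trans ?_, h2.trans ?_, h3⟩
  · exact sum_sum_ite_lefIndex_zero
      (fun a st ↦ Module.finrank ℂ ↥(A.typePiece a st ⊓ primitiveClasses D.Hη n a))
      (fun a st _ ↦ st.1.1 % 2 = 0)
  · exact sum_sum_ite_lefIndex_zero
      (fun a st ↦ Module.finrank ℂ ↥(A.typePiece a st ⊓ primitiveClasses D.Hη n a))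
      (fun a st _ ↦ st.1.1 % 2 = 1)

/-- **The index of the polarization on `Pᵏ_ℝ` in Hodge numbers** (`k` even, `k ≤ n`):
`b⁺ = Σ_{s+t'=k, s even} (h^{s,t'} - h^{s-1,t'-1})`, `b⁻ = Σ_{s odd} (h^{s,t'} - h^{s-1,t'-1})`
(`dim (H^{s,t'} ∩ Pᵏ) = h^{s,t'} - h^{s-1,t'-1}` for `k ≤ n`, with `h^{s-1,t'-1} = 0` if `s = 0` or
`t' = 0`; `finrank_typePiece_inf_primitiveClasses_eq_sub`), as integers.
[cite: VoisinHodgeI2002, §6.3.2 Thm. 6.32 and §7.1.2 (i)–(ii)] [cite: CarlsonMullerStachPeters2017, §4.4 (PDF p. 138)] -/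
theorem signature_lefschetzForm_restrict_primitive_eq_sum_hodgeNumber (hX : IsSmoothProjective n X)
    (A : HodgeModel n X) {k r m : ℕ} (hk : Even k) (hkr : k + r = n) (hm : k + 2 * r = m)
    (hdeg : m + k = 2 * n) (μ : HomologicalOrientation ℤ (Motives.ComplexPoints X) (2 * n))
    (hP : 0 < kroneckerPairing ℝ ℝ (Motives.ComplexPoints X) (2 * n)
      (reClass _ (2 * n) D.topClass)
      (singularHomology.coeffChange (Motives.ComplexPoints X)
        (algebraMap ℤ ℝ : ℤ →+* ℝ).toAddMonoidHom (2 * n) μ.fundamentalClass))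
    (U : Submodule ℝ (singularCohomology ℝ ℝ (Motives.ComplexPoints X) k))
    (hU : ∀ y, y ∈ U ↔ ofRealClass _ k y ∈ primitiveClasses D.Hη n k) :
    ((sigPos ((LinearMap.BilinMap.toQuadraticMap
        (((cupProduct (R := ℝ) (X := Motives.ComplexPoints X) hdeg).compr₂
          ((kroneckerPairing ℝ ℝ (Motives.ComplexPoints X) (2 * n)).flip
            (singularHomology.coeffChange (Motives.ComplexPoints X)
              (algebraMap ℤ ℝ : ℤ →+* ℝ).toAddMonoidHom (2 * n) μ.fundamentalClass))) ∘ₗ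
          lefschetzPowTo (reClass (Motives.ComplexPoints X) 2 D.Hη) r k m hm)).restrict U) : ℕ) : ℤ) =
        ∑ st : ↥(Finset.HasAntidiagonal.antidiagonal k), (if st.1.1 % 2 = 0 then
          (Module.finrank ℂ (A.hodgePQ (st.1.1 + st.1.2) st.1.1 st.1.2) : ℤ) -
            (if 0 < st.1.1 ∧ 0 < st.1.2 then
              (Module.finrank ℂ (A.hodgePQ (st.1.1 - 1 + (st.1.2 - 1)) (st.1.1 - 1) (st.1.2 - 1)) : ℤ)
            else 0) else 0) ∧
      ((sigNeg ((LinearMap.BilinMap.toQuadraticMap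
        (((cupProduct (R := ℝ) (X := Motives.ComplexPoints X) hdeg).compr₂
          ((kroneckerPairing ℝ ℝ (Motives.ComplexPoints X) (2 * n)).flip
            (singularHomology.coeffChange (Motives.ComplexPoints X)
              (algebraMap ℤ ℝ : ℤ →+* ℝ).toAddMonoidHom (2 * n) μ.fundamentalClass))) ∘ₗ
          lefschetzPowTo (reClass (Motives.ComplexPoints X) 2 D.Hη) r k m hm)).restrict U) : ℕ) : ℤ) =
        ∑ st : ↥(Finset.HasAntidiagonal.antidiagonal k), (if st.1.1 % 2 = 1 then
          (Module.finrank ℂ (A.hodgePQ (st.1.1 + st.1.2) st.1.1 st.1.2) : ℤ) -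
            (if 0 < st.1.1 ∧ 0 < st.1.2 then
              (Module.finrank ℂ (A.hodgePQ (st.1.1 - 1 + (st.1.2 - 1)) (st.1.1 - 1) (st.1.2 - 1)) : ℤ)
            else 0) else 0) := by
  have hk' : k ≤ n := by omega
  obtain ⟨h1, h2, -⟩ :=
    D.sigPos_sigNeg_lefschetzForm_restrict_primitive_of_pos hX A hk hkr hm hdeg μ hP U hU
  rw [h1, h2, Nat.cast_sum, Nat.cast_sum]
  refine ⟨Finset.sum_congr rfl fun st _ ↦ ?_, Finset.sum_congr rfl fun st _ ↦ ?_⟩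
  · by_cases h : st.1.1 % 2 = 0
    · rw [if_pos h, if_pos h, D.finrank_typePiece_inf_primitiveClasses_eq_sub hX A hk' st]
    · rw [if_neg h, if_neg h, Nat.cast_zero]
  · by_cases h : st.1.1 % 2 = 1
    · rw [if_pos h, if_pos h, D.finrank_typePiece_inf_primitiveClasses_eq_sub hX A hk' st]
    · rw [if_neg h, if_neg h, Nat.cast_zero]

/-! ### The index on the real points of `Pᵏ ∩ ⊕_{(p,q) ∈ T} H^{p,q}` -/

/-- **The polarization on `(⊕_{(p,q) ∈ T} P^{p,q})_ℝ`** for a set of types `T` closed under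
`(p, q) ↦ (q, p)` (`k` even, `k + r = n`, `μ` positive, `U` the real classes whose complexification
is primitive and lies in `⊕_{T} H^{p,q}`): the restriction of `B_k` to `U` has
`b⁺ = Σ_{(s,t') ∈ T, s even} dim (H^{s,t'} ∩ Pᵏ)`, `b⁻ = Σ_{(s,t') ∈ T, s odd} dim (H^{s,t'} ∩ Pᵏ)`,
`b⁺ + b⁻ = dim_ℝ U` — so `B_k` is DEFINITE of sign `(-1)ᵖ` on `(P^{p,q} ⊕ P^{q,p})_ℝ` (`T = {(p,q),
(q,p)}`, `p ≡ q (mod 2)`) and positive/negative definite on `P^{m,m}_ℝ` according to the parity of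
`m` (`k = 2m`). [cite: VoisinHodgeI2002, §6.3.2 Thm. 6.32 and §7.1.2 (i)–(ii)]
[cite: CarlsonMullerStachPeters2017, §4.4 (PDF p. 138)] -/
theorem sigPos_sigNeg_lefschetzForm_restrict_primitive_types_of_pos (hX : IsSmoothProjective n X)
    (A : HodgeModel n X) {k r m : ℕ} (hk : Even k) (hkr : k + r = n) (hm : k + 2 * r = m)
    (hdeg : m + k = 2 * n) (μ : HomologicalOrientation ℤ (Motives.ComplexPoints X) (2 * n))
    (hP : 0 < kroneckerPairing ℝ ℝ (Motives.ComplexPoints X) (2 * n)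
      (reClass _ (2 * n) D.topClass)
      (singularHomology.coeffChange (Motives.ComplexPoints X)
        (algebraMap ℤ ℝ : ℤ →+* ℝ).toAddMonoidHom (2 * n) μ.fundamentalClass))
    (τ : ℕ × ℕ → Prop) [DecidablePred τ] (hτ : ∀ p q, τ (p, q) → τ (q, p))
    (U : Submodule ℝ (singularCohomology ℝ ℝ (Motives.ComplexPoints X) k))
    (hU : ∀ y, y ∈ U ↔ ofRealClass _ k y ∈ primitiveClasses D.Hη n k ∧
      ofRealClass _ k y ∈
        ⨆ pq : ↥(Finset.HasAntidiagonal.antidiagonal k), ⨆ (_ : τ pq.1), A.typePiece k pq) :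
    sigPos ((LinearMap.BilinMap.toQuadraticMap
        (((cupProduct (R := ℝ) (X := Motives.ComplexPoints X) hdeg).compr₂
          ((kroneckerPairing ℝ ℝ (Motives.ComplexPoints X) (2 * n)).flip
            (singularHomology.coeffChange (Motives.ComplexPoints X)
              (algebraMap ℤ ℝ : ℤ →+* ℝ).toAddMonoidHom (2 * n) μ.fundamentalClass))) ∘ₗ
          lefschetzPowTo (reClass (Motives.ComplexPoints X) 2 D.Hη) r k m hm)).restrict U) =
        ∑ st : ↥(Finset.HasAntidiagonal.antidiagonal k), (if τ st.1 ∧ st.1.1 % 2 = 0 then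
          Module.finrank ℂ ↥(A.typePiece k st ⊓ primitiveClasses D.Hη n k) else 0) ∧
      sigNeg ((LinearMap.BilinMap.toQuadraticMap
        (((cupProduct (R := ℝ) (X := Motives.ComplexPoints X) hdeg).compr₂
          ((kroneckerPairing ℝ ℝ (Motives.ComplexPoints X) (2 * n)).flip
            (singularHomology.coeffChange (Motives.ComplexPoints X)
              (algebraMap ℤ ℝ : ℤ →+* ℝ).toAddMonoidHom (2 * n) μ.fundamentalClass))) ∘ₗ
          lefschetzPowTo (reClass (Motives.ComplexPoints X) 2 D.Hη) r k m hm)).restrict U) =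
        ∑ st : ↥(Finset.HasAntidiagonal.antidiagonal k), (if τ st.1 ∧ st.1.1 % 2 = 1 then
          Module.finrank ℂ ↥(A.typePiece k st ⊓ primitiveClasses D.Hη n k) else 0) ∧
      sigPos ((LinearMap.BilinMap.toQuadraticMap
        (((cupProduct (R := ℝ) (X := Motives.ComplexPoints X) hdeg).compr₂
          ((kroneckerPairing ℝ ℝ (Motives.ComplexPoints X) (2 * n)).flip
            (singularHomology.coeffChange (Motives.ComplexPoints X)
              (algebraMap ℤ ℝ : ℤ →+* ℝ).toAddMonoidHom (2 * n) μ.fundamentalClass))) ∘ₗ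
          lefschetzPowTo (reClass (Motives.ComplexPoints X) 2 D.Hη) r k m hm)).restrict U) +
      sigNeg ((LinearMap.BilinMap.toQuadraticMap
        (((cupProduct (R := ℝ) (X := Motives.ComplexPoints X) hdeg).compr₂
          ((kroneckerPairing ℝ ℝ (Motives.ComplexPoints X) (2 * n)).flip
            (singularHomology.coeffChange (Motives.ComplexPoints X)
              (algebraMap ℤ ℝ : ℤ →+* ℝ).toAddMonoidHom (2 * n) μ.fundamentalClass))) ∘ₗ
          lefschetzPowTo (reClass (Motives.ComplexPoints X) 2 D.Hη) r k m hm)).restrict U) =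
        Module.finrank ℝ U := by
  have hk' : k ≤ n := by omega
  -- membership: primitive ∧ in the types `T` ⟺ all blocks outside `{t = 0, type ∈ T}` vanish
  have hU' : ∀ y, y ∈ U ↔ ofRealClass _ k y ∈ ⨅ P : {p : ℕ × ℕ // p.1 + 2 * p.2 = k},
      ⨅ st : ↥(Finset.HasAntidiagonal.antidiagonal P.1.1),
        ⨅ (_ : ¬ (fun P st ↦ P.1.2 = 0 ∧ τ (st.1.1 + P.1.2, st.1.2 + P.1.2)) P st),
        LinearMap.ker (A.typeProj P.1.1 st ∘ₗ
          primitivePart D.Hη n (D.hLℂ hX) (subsingleton_of_lt hX ℂ) P) := fun y ↦ by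
    rw [hU, D.mem_primitiveClasses_iff_typeProj_primitivePart_eq_zero hX A,
      D.mem_iSup_typePiece_iff hX A hk' τ]
    simp only [Submodule.mem_iInf, LinearMap.mem_ker, LinearMap.comp_apply, ne_eq, not_and_or]
    constructor
    · rintro ⟨h1, h2⟩ P st (h | h)
      · exact h1 P st h
      · exact h2 P st h
    · intro h
      exact ⟨fun P st hP ↦ h P st (Or.inl hP), fun P st hτ' ↦ h P st (Or.inr hτ')⟩
  obtain ⟨h1, h2, h3⟩ := D.sigPos_sigNeg_lefschetzForm_restrict_eq_sum_of_pos hX A hk hkr hm hdeg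
    μ hP (fun P st ↦ P.1.2 = 0 ∧ τ (st.1.1 + P.1.2, st.1.2 + P.1.2)) (fun P st h ↦ ⟨h.1, hτ _ _ h.2⟩)
    U hU'
  have hev : ∀ (e : ℕ), (∑ P : {x : ℕ × ℕ // x.1 + 2 * x.2 = k},
      ∑ st : ↥(Finset.HasAntidiagonal.antidiagonal P.1.1),
        (if (P.1.2 = 0 ∧ τ (st.1.1 + P.1.2, st.1.2 + P.1.2)) ∧ st.1.1 % 2 = e then
          Module.finrank ℂ ↥(A.typePiece P.1.1 st ⊓ primitiveClasses D.Hη n P.1.1) else 0)) =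
      ∑ st : ↥(Finset.HasAntidiagonal.antidiagonal k), (if τ st.1 ∧ st.1.1 % 2 = e then
          Module.finrank ℂ ↥(A.typePiece k st ⊓ primitiveClasses D.Hη n k) else 0) := by
    intro e
    have h := sum_sum_ite_lefIndex_zero (k := k)
      (fun a st ↦ Module.finrank ℂ ↥(A.typePiece a st ⊓ primitiveClasses D.Hη n a))
      (fun a st t ↦ τ (st.1.1 + t, st.1.2 + t) ∧ st.1.1 % 2 = e)
    simp only [Nat.add_zero, Prod.mk.eta] at h
    rw [← h]
    refine Finset.sum_congr rfl fun P _ ↦ Finset.sum_congr rfl fun st _ ↦ ?_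
    simp only [and_assoc]
  exact ⟨h1.trans (hev 0), h2.trans (hev 1), h3⟩

/-! ### The case `k = 2`: the index `(2 h^{2,0}, h^{1,1} - 1)` on `P²_ℝ` -/

/-- **On the real primitive classes of degree two the form `∫ ω^{n-2} ∧ α ∧ β` has index
`(2 h^{2,0}, h^{1,1} - 1)`** (`X` smooth projective of dimension `n ≥ 2`, `2 + r = n`, `μ`
positive): `P² = H^{2,0} ⊕ H^{1,1}_prim ⊕ H^{0,2}`, positive on `(H^{2,0} ⊕ H^{0,2})_ℝ` (dimension
`2 h^{2,0}`, Hodge symmetry), negative on `H^{1,1}_{prim,ℝ}` (dimension `h^{1,1} - h^{0,0} = h^{1,1} - 1`).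
[cite: VoisinHodgeI2002, §6.3.2 Thm. 6.32 and §7.1.2 (i)–(ii)] [cite: HuybrechtsCG2005, §3.3 Cor. 3.3.16] -/
theorem sigPos_sigNeg_lefschetzForm_restrict_primitive_two_of_pos (hX : IsSmoothProjective n X)
    (A : HodgeModel n X) {r m : ℕ} (hr : 2 + r = n) (hm : 2 + 2 * r = m) (hdeg : m + 2 = 2 * n)
    (μ : HomologicalOrientation ℤ (Motives.ComplexPoints X) (2 * n))
    (hP : 0 < kroneckerPairing ℝ ℝ (Motives.ComplexPoints X) (2 * n)
      (reClass _ (2 * n) D.topClass)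
      (singularHomology.coeffChange (Motives.ComplexPoints X)
        (algebraMap ℤ ℝ : ℤ →+* ℝ).toAddMonoidHom (2 * n) μ.fundamentalClass))
    (U : Submodule ℝ (singularCohomology ℝ ℝ (Motives.ComplexPoints X) 2))
    (hU : ∀ y, y ∈ U ↔ ofRealClass _ 2 y ∈ primitiveClasses D.Hη n 2) :
    sigPos ((LinearMap.BilinMap.toQuadraticMap
        (((cupProduct (R := ℝ) (X := Motives.ComplexPoints X) hdeg).compr₂
          ((kroneckerPairing ℝ ℝ (Motives.ComplexPoints X) (2 * n)).flip
            (singularHomology.coeffChange (Motives.ComplexPoints X)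
              (algebraMap ℤ ℝ : ℤ →+* ℝ).toAddMonoidHom (2 * n) μ.fundamentalClass))) ∘ₗ
          lefschetzPowTo (reClass (Motives.ComplexPoints X) 2 D.Hη) r 2 m hm)).restrict U) =
        2 * Module.finrank ℂ (A.hodgePQ 2 2 0) ∧
      sigNeg ((LinearMap.BilinMap.toQuadraticMap
        (((cupProduct (R := ℝ) (X := Motives.ComplexPoints X) hdeg).compr₂
          ((kroneckerPairing ℝ ℝ (Motives.ComplexPoints X) (2 * n)).flip
            (singularHomology.coeffChange (Motives.ComplexPoints X)
              (algebraMap ℤ ℝ : ℤ →+* ℝ).toAddMonoidHom (2 * n) μ.fundamentalClass))) ∘ₗ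
          lefschetzPowTo (reClass (Motives.ComplexPoints X) 2 D.Hη) r 2 m hm)).restrict U) + 1 =
        Module.finrank ℂ (A.hodgePQ 2 1 1) := by
  obtain ⟨h1, h2, -⟩ := D.sigPos_sigNeg_lefschetzForm_restrict_primitive_of_pos hX A (k := 2)
    ⟨1, rfl⟩ hr hm hdeg μ hP U hU
  have h02 : ((0, 2) : ℕ × ℕ) ∈ Finset.HasAntidiagonal.antidiagonal 2 :=
    Finset.HasAntidiagonal.mem_antidiagonal.2 rfl
  have h11 : ((1, 1) : ℕ × ℕ) ∈ Finset.HasAntidiagonal.antidiagonal 2 :=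
    Finset.HasAntidiagonal.mem_antidiagonal.2 rfl
  have h20 : ((2, 0) : ℕ × ℕ) ∈ Finset.HasAntidiagonal.antidiagonal 2 :=
    Finset.HasAntidiagonal.mem_antidiagonal.2 rfl
  have h00 : ((0, 0) : ℕ × ℕ) ∈ Finset.HasAntidiagonal.antidiagonal 0 :=
    Finset.HasAntidiagonal.mem_antidiagonal.2 rfl
  have h2ad : (Finset.univ : Finset ↥(Finset.HasAntidiagonal.antidiagonal 2)) =
      {⟨(0, 2), h02⟩, ⟨(1, 1), h11⟩, ⟨(2, 0), h20⟩} := by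
    ext ⟨⟨p, q⟩, hpq⟩
    have hpq' := Finset.HasAntidiagonal.mem_antidiagonal.1 hpq
    simp only [Finset.mem_univ, Finset.mem_insert, Finset.mem_singleton, Subtype.mk.injEq,
      Prod.mk.injEq, true_iff]
    omega
  have hsum2 : ∀ f : ↥(Finset.HasAntidiagonal.antidiagonal 2) → ℕ,
      ∑ st, f st = f ⟨(0, 2), h02⟩ + f ⟨(1, 1), h11⟩ + f ⟨(2, 0), h20⟩ := fun f ↦ by
    rw [h2ad, Finset.sum_insert (by simp), Finset.sum_insert (by simp), Finset.sum_singleton, add_assoc]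
  have hexp0 : ∀ d : ↥(Finset.HasAntidiagonal.antidiagonal 2) → ℕ,
      (∑ st, if st.1.1 % 2 = 0 then d st else 0) = d ⟨(0, 2), h02⟩ + d ⟨(2, 0), h20⟩ := by
    intro d
    rw [hsum2]
    simp
  have hexp1 : ∀ d : ↥(Finset.HasAntidiagonal.antidiagonal 2) → ℕ,
      (∑ st, if st.1.1 % 2 = 1 then d st else 0) = d ⟨(1, 1), h11⟩ := by
    intro d
    rw [hsum2]
    simp
  -- the primitive Hodge numbers of degree two
  have f02 : Module.finrank ℂ ↥(A.typePiece 2 ⟨(0, 2), h02⟩ ⊓ primitiveClasses D.Hη n 2) =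
      Module.finrank ℂ (A.hodgePQ 2 2 0) :=
    (D.finrank_typePiece_inf_primitiveClasses_of_fst_eq_zero hX A (by omega) rfl h02).trans
      ((A.finrank_typePiece_eq_finrank_hodgePQ h02).trans
        (A.finrank_hodgePQ_symm hX (k := 2) (p := 0) (q := 2) rfl))
  have f20 : Module.finrank ℂ ↥(A.typePiece 2 ⟨(2, 0), h20⟩ ⊓ primitiveClasses D.Hη n 2) =
      Module.finrank ℂ (A.hodgePQ 2 2 0) :=
    (D.finrank_typePiece_inf_primitiveClasses_of_snd_eq_zero hX A (by omega) rfl h20).trans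
      (A.finrank_typePiece_eq_finrank_hodgePQ h20)
  have f11 : Module.finrank ℂ ↥(A.typePiece 2 ⟨(1, 1), h11⟩ ⊓ primitiveClasses D.Hη n 2) + 1 =
      Module.finrank ℂ (A.hodgePQ 2 1 1) := by
    have h := D.finrank_typePiece_inf_primitiveClasses_succ hX A (a₀ := 0) (a := 2) (by omega)
      (by omega) (s₀ := 0) (t₀ := 0) (s := 1) (t := 1) rfl rfl h11 h00
    rw [A.finrank_typePiece_eq_finrank_hodgePQ h00, A.finrank_hodgePQ_zero_zero_zero hX,
      A.finrank_typePiece_eq_finrank_hodgePQ h11] at h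
    exact h
  refine ⟨?_, ?_⟩
  · rw [h1, hexp0, f02, f20]
    ring
  · rw [h2, hexp1]
    exact f11

/-! ### Orientation-free packaging -/

/-- **The index of the polarization on `Pᵏ_ℝ`, orientation-free**: for `X` smooth projective of
dimension `n = k + r`, `k` even, and a Kähler–rational datum `D` there is a `ℤ`-orientation `μ` of
`X(ℂ)` — every orientation is `±μ` — such that, for every Hodge model and every real primitive
subspace `U = Pᵏ_ℝ`, the restriction of `⟨Lʳ_{re H_η} y ⌣ y', [X(ℂ)]_μ ⊗ 1⟩` to `U` has
`b⁺ = Σ_{s even} dim (H^{s,t'} ∩ Pᵏ)`, `b⁻ = Σ_{s odd} dim (H^{s,t'} ∩ Pᵏ)`, `b⁺ + b⁻ = dim_ℝ U`.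
[cite: VoisinHodgeI2002, §6.3.2 Thm. 6.32 and §7.1.2 (i)–(ii)] [cite: CarlsonMullerStachPeters2017, §4.4 (PDF p. 138)] -/
theorem exists_orientation_sigPos_sigNeg_lefschetzForm_restrict_primitive
    (hX : IsSmoothProjective n X) {k r m : ℕ} (hk : Even k) (hkr : k + r = n) (hm : k + 2 * r = m)
    (hdeg : m + k = 2 * n) :
    ∃ μ : HomologicalOrientation ℤ (Motives.ComplexPoints X) (2 * n),
      (∀ ν : HomologicalOrientation ℤ (Motives.ComplexPoints X) (2 * n), ν = μ ∨ ν = -μ) ∧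
      ∀ (A : HodgeModel n X) (U : Submodule ℝ (singularCohomology ℝ ℝ (Motives.ComplexPoints X) k)),
        (∀ y, y ∈ U ↔ ofRealClass _ k y ∈ primitiveClasses D.Hη n k) →
        sigPos ((LinearMap.BilinMap.toQuadraticMap
            (((cupProduct (R := ℝ) (X := Motives.ComplexPoints X) hdeg).compr₂
              ((kroneckerPairing ℝ ℝ (Motives.ComplexPoints X) (2 * n)).flip
                (singularHomology.coeffChange (Motives.ComplexPoints X)
                  (algebraMap ℤ ℝ : ℤ →+* ℝ).toAddMonoidHom (2 * n) μ.fundamentalClass))) ∘ₗ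
              lefschetzPowTo (reClass (Motives.ComplexPoints X) 2 D.Hη) r k m hm)).restrict U) =
            ∑ st : ↥(Finset.HasAntidiagonal.antidiagonal k), (if st.1.1 % 2 = 0 then
              Module.finrank ℂ ↥(A.typePiece k st ⊓ primitiveClasses D.Hη n k) else 0) ∧
        sigNeg ((LinearMap.BilinMap.toQuadraticMap
            (((cupProduct (R := ℝ) (X := Motives.ComplexPoints X) hdeg).compr₂
              ((kroneckerPairing ℝ ℝ (Motives.ComplexPoints X) (2 * n)).flip
                (singularHomology.coeffChange (Motives.ComplexPoints X)
                  (algebraMap ℤ ℝ : ℤ →+* ℝ).toAddMonoidHom (2 * n) μ.fundamentalClass))) ∘ₗ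
              lefschetzPowTo (reClass (Motives.ComplexPoints X) 2 D.Hη) r k m hm)).restrict U) =
            ∑ st : ↥(Finset.HasAntidiagonal.antidiagonal k), (if st.1.1 % 2 = 1 then
              Module.finrank ℂ ↥(A.typePiece k st ⊓ primitiveClasses D.Hη n k) else 0) ∧
        sigPos ((LinearMap.BilinMap.toQuadraticMap
            (((cupProduct (R := ℝ) (X := Motives.ComplexPoints X) hdeg).compr₂
              ((kroneckerPairing ℝ ℝ (Motives.ComplexPoints X) (2 * n)).flip
                (singularHomology.coeffChange (Motives.ComplexPoints X)
                  (algebraMap ℤ ℝ : ℤ →+* ℝ).toAddMonoidHom (2 * n) μ.fundamentalClass))) ∘ₗ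
              lefschetzPowTo (reClass (Motives.ComplexPoints X) 2 D.Hη) r k m hm)).restrict U) +
        sigNeg ((LinearMap.BilinMap.toQuadraticMap
            (((cupProduct (R := ℝ) (X := Motives.ComplexPoints X) hdeg).compr₂
              ((kroneckerPairing ℝ ℝ (Motives.ComplexPoints X) (2 * n)).flip
                (singularHomology.coeffChange (Motives.ComplexPoints X)
                  (algebraMap ℤ ℝ : ℤ →+* ℝ).toAddMonoidHom (2 * n) μ.fundamentalClass))) ∘ₗ
              lefschetzPowTo (reClass (Motives.ComplexPoints X) 2 D.Hη) r k m hm)).restrict U) =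
          Module.finrank ℝ U := by
  obtain ⟨μ, hall, hP⟩ := D.exists_orientation_kroneckerPairing_reClass_topClass_pos_of_dim hX
  exact ⟨μ, hall, fun A U hU ↦
    D.sigPos_sigNeg_lefschetzForm_restrict_primitive_of_pos hX A hk hkr hm hdeg μ hP U hU⟩

end KaehlerRationalDatum

end Primitive

end Literature.AlgebraicGeometry.HodgeTheory

end
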